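import Summits.AnomalousDissipation.AnomalousDissipation.Theorems.LimitingAbsorptionRelaxationBoundsInventoryShift
import Summits.AnomalousDissipation.AnomalousDissipation.Theorems.LimitingAbsorptionRelaxationBoundsInventorySums
import Literature.Analysis.FluidPDE.PassiveScalarExistenceApprox
import Literature.Analysis.FunctionSpaces.SpaceTimeWeakCompactness
import HarnessLib

/-!
# Route LimitingAbsorption — `RelaxationBoundsInventory`, III: the Riemann–Duhamel superposition

Support lemmas for item stmt-AnomalousDissipation-2940 (`RelaxationBoundsInventory`, route
`route-AnomalousDissipation-LimitingAbsorption`). Fix a horizon `T > 0`, a step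
`δ = T/(N+1)` and, for every `k`, a weak solution `Θ_k` of the homogeneous passive scalar equation
on `[0, T - kδ)` with the shifted drift `u(kδ + ·)` and datum `h` (a release of the profile `h` at
phase `kδ`). The RIEMANN–DUHAMEL SUPERPOSITION is the field

  `W_N(t, x) = ∑_{k ≤ N} δ · Λ_k(t, x)`, `Λ_k(t, x) = Θ_k(t - kδ, x)` (`t > kδ`), `0` (`t ≤ kδ`),

a left Riemann sum of the Duhamel integral `∫₀ᵗ U(t,s) h ds` (Pazy 1983, Ch. 5, §5.1–5.2). This
file proves (no definition is introduced; `W_N` is written out):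

* `exists_bound_weakIntegrand` — the weak-form integrand `∂ₜψ + u·∇ψ + κΔψ` of a test function is
  measurable and essentially bounded on `(0,T) × T^d` for an essentially bounded drift;
* `aestronglyMeasurable_uncurry_superposition` — `W_N` is measurable on `(0,T) × T^d`;
* `ae_eLpNorm_superposition_le` — **Minkowski + phase-uniform relaxation**: if
  `‖Θ_k(τ)‖_{L²} ≤ A e^{-γτ/2} σ` for a.e. `τ`, then `‖W_N(t)‖_{L²} ≤ A σ (2/γ + δ)` for a.e.
  `t ∈ (0,T)` (`LapInventory.sum_step_mul_exp_le`);
* `integral_superposition_mul_weakIntegrand` — **the weak identity of `W_N`**: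
  `∫₀ᵀ∫ W_N (∂ₜψ + u·∇ψ + κΔψ) = -∑_{k ≤ N} δ ∫ h ψ(kδ)`, i.e. `W_N` is a distributional solution of
  the sourced equation with the time-discrete source `∑_k δ h ⊗ δ_{t = kδ}` and zero datum
  (sum of `LapInventory.integral_release_mul_weakIntegrand`).

## References

* A. Pazy, *Semigroups of Linear Operators and Applications to PDE* (Springer 1983), Ch. 5,
  §5.1–5.2. [`Pazy1983`]
* R. J. DiPerna, P.-L. Lions, Invent. Math. 98 (1989), §II.1. [`DiPernaLions1989`]
-/

noncomputable section

open MeasureTheory Set Filter Function TopologicalSpace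
open scoped ENNReal NNReal InnerProductSpace

namespace Summit.AnomalousDissipation.AnomalousDissipation.Theorems

-- D-0017: single-problem summit ⇒ `Summit.AnomalousDissipation.AnomalousDissipation.…` by design.
set_option linter.dupNamespace false

namespace LapInventory

open Literature.Analysis Literature.Analysis.FluidPDE Literature.Analysis.FluidPDE.Torus

variable {d : Type*} [Fintype d]

/-! ## The weak-form integrand of a test function over a bounded drift -/

/-- **The weak-form integrand is bounded.** For an essentially bounded drift `u` on
`(0,T) × T^d` and a space–time test function `ψ` on `[0,T)`, the integrand
`G = ∂ₜψ + u·∇ψ + κΔψ` is a.e.-strongly measurable and essentially bounded on `(0,T) × T^d`;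
in particular `∫₀ᵀ∫ |G|² < ∞`. [folklore] -/
theorem exists_bound_weakIntegrand {T κ : ℝ} {u : ℝ → UnitAddTorus d → EuclideanSpace ℝ d}
    {ψ : ℝ → UnitAddTorus d → ℝ}
    (hu : MemLp (FunctionSpaces.Torus.stLift u) ⊤ (volume.restrict (Ioo 0 T ×ˢ univ)))
    (hψ : FunctionSpaces.Torus.IsSpaceTimeTest T ψ) :
    ∃ M : ℝ, AEStronglyMeasurable (uncurry fun t x =>
        FunctionSpaces.Torus.timeDeriv ψ t x + ⟪u t x, FunctionSpaces.Torus.gradient (ψ t) x⟫_ℝ +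
          κ * FunctionSpaces.Torus.laplacian (ψ t) x)
        (((volume : Measure ℝ).restrict (Ioo 0 T)).prod (volume : Measure (UnitAddTorus d))) ∧
      (∀ᵐ p ∂(((volume : Measure ℝ).restrict (Ioo 0 T)).prod (volume : Measure (UnitAddTorus d))),
        ‖FunctionSpaces.Torus.timeDeriv ψ p.1 p.2 + ⟪u p.1 p.2, FunctionSpaces.Torus.gradient (ψ p.1) p.2⟫_ℝ +
          κ * FunctionSpaces.Torus.laplacian (ψ p.1) p.2‖ ≤ M) ∧
      ∫⁻ t in Ioo 0 T, ∫⁻ x, ‖FunctionSpaces.Torus.timeDeriv ψ t x + ⟪u t x, FunctionSpaces.Torus.gradient (ψ t) x⟫_ℝ +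
          κ * FunctionSpaces.Torus.laplacian (ψ t) x‖ₑ ^ 2 < ⊤ := by
  set μ : Measure (ℝ × UnitAddTorus d) :=
    ((volume : Measure ℝ).restrict (Ioo 0 T)).prod (volume : Measure (UnitAddTorus d)) with hμ
  haveI : IsFiniteMeasure ((volume : Measure ℝ).restrict (Ioo 0 T)) :=
    isFiniteMeasure_restrict.2 measure_Ioo_lt_top.ne
  haveI : IsFiniteMeasure μ := by rw [hμ]; infer_instance
  obtain ⟨Cu, hCu0, hCu⟩ := ae_norm_le_prod_of_memLp_top_stLift hu
  have hum : AEStronglyMeasurable (uncurry u) μ :=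
    FunctionSpaces.Torus.aestronglyMeasurable_uncurry_of_stLift_prod hu.1
  obtain ⟨C₁, hC₁⟩ := exists_bound_of_continuous_uncurry hψ.continuous_uncurry_timeDeriv 0 T
  obtain ⟨C₂, hC₂⟩ := exists_bound_of_continuous_uncurry hψ.continuous_uncurry_gradient 0 T
  obtain ⟨C₃, hC₃⟩ := exists_bound_of_continuous_uncurry hψ.continuous_uncurry_laplacian 0 T
  have hae : ∀ᵐ p ∂μ, p.1 ∈ Ioo 0 T :=
    (Measure.quasiMeasurePreserving_fst (μ := (volume : Measure ℝ).restrict (Ioo 0 T))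
      (ν := (volume : Measure (UnitAddTorus d)))).ae (ae_restrict_mem measurableSet_Ioo)
  set M : ℝ := C₁ + Cu * C₂ + |κ| * C₃ with hM
  have hGbd : ∀ᵐ p ∂μ, ‖FunctionSpaces.Torus.timeDeriv ψ p.1 p.2 +
      ⟪u p.1 p.2, FunctionSpaces.Torus.gradient (ψ p.1) p.2⟫_ℝ + κ * FunctionSpaces.Torus.laplacian (ψ p.1) p.2‖ ≤ M := by
    filter_upwards [hae, hCu] with p hp hpu
    have hp' : p.1 ∈ Icc 0 T := Ioo_subset_Icc_self hp
    have h1 : ‖FunctionSpaces.Torus.timeDeriv ψ p.1 p.2‖ ≤ C₁ := hC₁ p.1 hp' p.2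
    have h2 : ‖⟪u p.1 p.2, FunctionSpaces.Torus.gradient (ψ p.1) p.2⟫_ℝ‖ ≤ Cu * C₂ :=
      (norm_inner_le_norm _ _).trans (mul_le_mul hpu (hC₂ p.1 hp' p.2) (norm_nonneg _) hCu0)
    have h3 : ‖κ * FunctionSpaces.Torus.laplacian (ψ p.1) p.2‖ ≤ |κ| * C₃ := by
      rw [norm_mul, Real.norm_eq_abs]
      exact mul_le_mul_of_nonneg_left (hC₃ p.1 hp' p.2) (abs_nonneg _)
    exact (norm_add₃_le.trans (add_le_add (add_le_add h1 h2) h3))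
  have hGm : AEStronglyMeasurable (uncurry fun t x =>
      FunctionSpaces.Torus.timeDeriv ψ t x + ⟪u t x, FunctionSpaces.Torus.gradient (ψ t) x⟫_ℝ +
        κ * FunctionSpaces.Torus.laplacian (ψ t) x) μ := by
    change AEStronglyMeasurable (fun p : ℝ × UnitAddTorus d =>
      FunctionSpaces.Torus.timeDeriv ψ p.1 p.2 + ⟪u p.1 p.2, FunctionSpaces.Torus.gradient (ψ p.1) p.2⟫_ℝ +
        κ * FunctionSpaces.Torus.laplacian (ψ p.1) p.2) μ
    refine ((?_ : AEStronglyMeasurable _ μ).add ?_).add ?_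
    · exact hψ.continuous_uncurry_timeDeriv.aestronglyMeasurable
    · exact hum.inner hψ.continuous_uncurry_gradient.aestronglyMeasurable
    · exact (continuous_const.mul hψ.continuous_uncurry_laplacian).aestronglyMeasurable
  refine ⟨M, hGm, hGbd, ?_⟩
  have h1 : ∫⁻ p, ‖(uncurry fun t x =>
      FunctionSpaces.Torus.timeDeriv ψ t x + ⟪u t x, FunctionSpaces.Torus.gradient (ψ t) x⟫_ℝ +
        κ * FunctionSpaces.Torus.laplacian (ψ t) x) p‖ₑ ^ 2 ∂μ ≤ ∫⁻ _, ENNReal.ofReal M ^ 2 ∂μ := by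
    refine lintegral_mono_ae ?_
    filter_upwards [hGbd] with p hp
    gcongr
    rw [← ofReal_norm]
    exact ENNReal.ofReal_le_ofReal hp
  rw [lintegral_prod _ (hGm.aemeasurable.enorm.pow_const 2)] at h1
  refine lt_of_le_of_lt h1 ?_
  rw [lintegral_const]
  exact ENNReal.mul_lt_top (ENNReal.pow_lt_top ENNReal.ofReal_lt_top) (measure_lt_top _ _)

/-! ## The superposition -/

section Superposition

variable {T κ γ A σ : ℝ} {u : ℝ → UnitAddTorus d → EuclideanSpace ℝ d} {h : UnitAddTorus d → ℝ}
  {Θ : ℕ → ℝ → UnitAddTorus d → ℝ} {N : ℕ} {ψ : ℝ → UnitAddTorus d → ℝ}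

/-- **Measurability of the Riemann–Duhamel superposition** on `(0,T) × T^d`. [folklore] -/
theorem aestronglyMeasurable_uncurry_superposition (hT : 0 ≤ T)
    (hΘ : ∀ k : ℕ, IsWeakScalarTransportOn (T - k * (T / (N + 1))) κ
      (fun t => u (k * (T / (N + 1)) + t)) h (Θ k)) :
    AEStronglyMeasurable (uncurry fun t x => ∑ k ∈ Finset.range (N + 1),
        T / (N + 1) * (if (k : ℝ) * (T / (N + 1)) < t then Θ k (t - k * (T / (N + 1))) x else 0))
      (((volume : Measure ℝ).restrict (Ioo 0 T)).prod (volume : Measure (UnitAddTorus d))) := by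
  have hδ : 0 ≤ T / (N + 1) := by positivity
  have e : (uncurry fun t x => ∑ k ∈ Finset.range (N + 1),
      T / (N + 1) * (if (k : ℝ) * (T / (N + 1)) < t then Θ k (t - k * (T / (N + 1))) x else 0)) =
      fun p : ℝ × UnitAddTorus d => ∑ k ∈ Finset.range (N + 1), T / (N + 1) *
        (uncurry fun t x => if (k : ℝ) * (T / (N + 1)) < t then Θ k (t - k * (T / (N + 1))) x else 0) p := by
    funext p; rfl
  rw [e]
  refine Finset.aestronglyMeasurable_fun_sum _ fun k _ => ?_
  refine (aestronglyMeasurable_uncurry_release (mul_nonneg k.cast_nonneg hδ) ?_).const_mul _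
  exact (hΘ k).aestronglyMeasurable_uncurry

/-- **Minkowski + phase-uniform relaxation.** If every release decays as
`‖Θ_k(τ)‖_{L²} ≤ A e^{-γτ/2} σ` for a.e. `τ ∈ (0, T - kδ)` (`A, σ ≥ 0`, `γ > 0`), then the
superposition is bounded in `L²` uniformly in `N` and `T`:
`‖W_N(t)‖_{L²} ≤ ∑_{k : kδ < t} δ A e^{-γ(t-kδ)/2} σ ≤ A σ (2/γ + δ)` for a.e. `t ∈ (0,T)`
(triangle inequality in `L²` and `LapInventory.sum_step_mul_exp_le`; Pazy 1983, Ch. 5, §5.1,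
the estimate of the mild solution). [cite: Pazy1983, Ch. 5 §5.1] -/
theorem ae_eLpNorm_superposition_le (hT : 0 < T) (hγ : 0 < γ) (hA : 0 ≤ A) (hσ : 0 ≤ σ)
    (hΘ : ∀ k : ℕ, IsWeakScalarTransportOn (T - k * (T / (N + 1))) κ
      (fun t => u (k * (T / (N + 1)) + t)) h (Θ k))
    (hbd : ∀ k : ℕ, ∀ᵐ τ ∂((volume : Measure ℝ).restrict (Ioo 0 (T - k * (T / (N + 1))))),
      eLpNorm (Θ k τ) 2 volume ≤ ENNReal.ofReal (A * Real.exp (-(γ * τ) / 2) * σ)) :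
    ∀ᵐ t ∂((volume : Measure ℝ).restrict (Ioo 0 T)),
      eLpNorm (fun x => ∑ k ∈ Finset.range (N + 1),
        T / (N + 1) * (if (k : ℝ) * (T / (N + 1)) < t then Θ k (t - k * (T / (N + 1))) x else 0)) 2 volume ≤
        ENNReal.ofReal (A * σ * (2 / γ + T / (N + 1))) := by
  set δ : ℝ := T / (N + 1) with hδ
  have hδ0 : 0 < δ := by positivity
  -- per-release slice facts, transported to the time axis of the superposition
  have hk : ∀ k : ℕ, ∀ᵐ t ∂((volume : Measure ℝ).restrict (Ioo 0 T)),
      AEStronglyMeasurable (fun x => if (k : ℝ) * δ < t then Θ k (t - k * δ) x else 0) volume ∧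
      eLpNorm (fun x => if (k : ℝ) * δ < t then Θ k (t - k * δ) x else 0) 2 volume ≤
        ENNReal.ofReal (if (k : ℝ) * δ < t then A * Real.exp (-(γ * (t - k * δ)) / 2) * σ else 0) := by
    intro k
    refine ae_release_slice (T := T) (a := k * δ) (Θ := Θ k)
      (R := fun t φ => AEStronglyMeasurable φ volume ∧ eLpNorm φ 2 volume ≤
        ENNReal.ofReal (if (k : ℝ) * δ < t then A * Real.exp (-(γ * (t - k * δ)) / 2) * σ else 0)) ?_ ?_
    · filter_upwards [hbd k, (hΘ k).ae_aestronglyMeasurable_slice, ae_restrict_mem measurableSet_Ioo]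
        with τ hτ hm hτmem
      refine ⟨hm, ?_⟩
      have hpos : (k : ℝ) * δ < k * δ + τ := by linarith [hτmem.1]
      rw [if_pos hpos, add_sub_cancel_left]
      exact hτ
    · intro t _
      refine ⟨aestronglyMeasurable_const, ?_⟩
      have e : (fun _ : UnitAddTorus d => (0 : ℝ)) = 0 := rfl
      rw [e, eLpNorm_zero]
      exact zero_le
  have hk' := ae_all_iff.2 hk
  filter_upwards [hk', ae_restrict_mem measurableSet_Ioo] with t ht htmem
  -- Minkowski
  have e : (fun x => ∑ k ∈ Finset.range (N + 1), δ * (if (k : ℝ) * δ < t then Θ k (t - k * δ) x else 0)) =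
      ∑ k ∈ Finset.range (N + 1), fun x => δ * (if (k : ℝ) * δ < t then Θ k (t - k * δ) x else 0) := by
    funext x
    simp only [Finset.sum_apply]
  rw [e]
  calc eLpNorm (∑ k ∈ Finset.range (N + 1), fun x => δ * (if (k : ℝ) * δ < t then Θ k (t - k * δ) x else 0)) 2 volume
      ≤ ∑ k ∈ Finset.range (N + 1), eLpNorm (fun x => δ * (if (k : ℝ) * δ < t then Θ k (t - k * δ) x else 0)) 2 volume :=
        eLpNorm_sum_le (fun k _ => (ht k).1.const_mul δ) one_le_two
    _ ≤ ∑ k ∈ Finset.range (N + 1), ENNReal.ofReal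
          (δ * (if (k : ℝ) * δ < t then A * Real.exp (-(γ * (t - k * δ)) / 2) * σ else 0)) := by
        refine Finset.sum_le_sum fun k _ => ?_
        have e1 : (fun x => δ * (if (k : ℝ) * δ < t then Θ k (t - k * δ) x else 0)) =
            δ • fun x => (if (k : ℝ) * δ < t then Θ k (t - k * δ) x else 0) := by
          funext x; simp only [Pi.smul_apply, smul_eq_mul]
        rw [e1, eLpNorm_const_smul, Real.enorm_eq_ofReal hδ0.le, ENNReal.ofReal_mul hδ0.le]
        gcongr
        exact (ht k).2
    _ = ENNReal.ofReal (∑ k ∈ Finset.range (N + 1),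
          δ * (if (k : ℝ) * δ < t then A * Real.exp (-(γ * (t - k * δ)) / 2) * σ else 0)) := by
        rw [ENNReal.ofReal_sum_of_nonneg]
        intro k _
        refine mul_nonneg hδ0.le ?_
        split_ifs
        · positivity
        · exact le_rfl
    _ ≤ ENNReal.ofReal (A * σ * (2 / γ + δ)) := by
        refine ENNReal.ofReal_le_ofReal ?_
        have e2 : ∀ k : ℕ, δ * (if (k : ℝ) * δ < t then A * Real.exp (-(γ * (t - k * δ)) / 2) * σ else 0) =
            A * σ * (if (k : ℝ) * δ < t then δ * Real.exp (-(γ * (t - k * δ)) / 2) else 0) := by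
          intro k
          split_ifs <;> ring
        simp_rw [e2]
        rw [← Finset.mul_sum]
        exact mul_le_mul_of_nonneg_left (sum_step_mul_exp_le hγ hδ0 htmem.1.le (N + 1)) (mul_nonneg hA hσ)

/-- Squared `lintegral` form of `ae_eLpNorm_superposition_le`, the shape consumed by the weak-*
compactness theorem `Torus.exists_strictMono_weakLimit_of_lintegral_sq_le`. [folklore] -/
theorem ae_lintegral_sq_superposition_le (hT : 0 < T) (hγ : 0 < γ) (hA : 0 ≤ A) (hσ : 0 ≤ σ)
    (hΘ : ∀ k : ℕ, IsWeakScalarTransportOn (T - k * (T / (N + 1))) κ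
      (fun t => u (k * (T / (N + 1)) + t)) h (Θ k))
    (hbd : ∀ k : ℕ, ∀ᵐ τ ∂((volume : Measure ℝ).restrict (Ioo 0 (T - k * (T / (N + 1))))),
      eLpNorm (Θ k τ) 2 volume ≤ ENNReal.ofReal (A * Real.exp (-(γ * τ) / 2) * σ))
    {M : ℝ} (hM : A * σ * (2 / γ + T / (N + 1)) ≤ M) :
    ∀ᵐ t ∂((volume : Measure ℝ).restrict (Ioo 0 T)),
      ∫⁻ x, ‖(∑ k ∈ Finset.range (N + 1),
        T / (N + 1) * (if (k : ℝ) * (T / (N + 1)) < t then Θ k (t - k * (T / (N + 1))) x else 0))‖ₑ ^ 2 ≤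
        ((M.toNNReal ^ 2 : ℝ≥0) : ℝ≥0∞) := by
  filter_upwards [ae_eLpNorm_superposition_le hT hγ hA hσ hΘ hbd] with t ht
  have h2 := ht.trans (ENNReal.ofReal_le_ofReal hM)
  calc ∫⁻ x, ‖(∑ k ∈ Finset.range (N + 1),
        T / (N + 1) * (if (k : ℝ) * (T / (N + 1)) < t then Θ k (t - k * (T / (N + 1))) x else 0))‖ₑ ^ 2
      = eLpNorm (fun x => ∑ k ∈ Finset.range (N + 1),
          T / (N + 1) * (if (k : ℝ) * (T / (N + 1)) < t then Θ k (t - k * (T / (N + 1))) x else 0)) 2 volume ^ 2 :=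
        (FunctionSpaces.eLpNorm_two_pow_two_eq_lintegral _).symm
    _ ≤ ENNReal.ofReal M ^ 2 := pow_le_pow_left' h2 2
    _ = ((M.toNNReal ^ 2 : ℝ≥0) : ℝ≥0∞) := by rw [ENNReal.coe_pow]; rfl

/-- **The weak identity of the Riemann–Duhamel superposition.** For an essentially bounded drift
on `(0,T) × T^d` and releases `Θ_k` as above, the superposition `W_N` satisfies, for every
space–time test function `ψ` on `[0,T)`,
`∫₀ᵀ∫ W_N (∂ₜψ + u·∇ψ + κΔψ) = -∑_{k ≤ N} δ ∫ h ψ(kδ)`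
(linearity of the distributional formulation and `LapInventory.integral_release_mul_weakIntegrand`
for each release; Pazy 1983, Ch. 5, §5.2: Riemann sums of the variation-of-constants formula).
[cite: Pazy1983, Ch. 5 §5.2] -/
theorem integral_superposition_mul_weakIntegrand (hT : 0 < T)
    (hu : MemLp (FunctionSpaces.Torus.stLift u) ⊤ (volume.restrict (Ioo 0 T ×ˢ univ)))
    (hΘ : ∀ k : ℕ, IsWeakScalarTransportOn (T - k * (T / (N + 1))) κ
      (fun t => u (k * (T / (N + 1)) + t)) h (Θ k))
    (hψ : FunctionSpaces.Torus.IsSpaceTimeTest T ψ) :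
    (∫ t in Ioo 0 T, ∫ x, (∑ k ∈ Finset.range (N + 1),
        T / (N + 1) * (if (k : ℝ) * (T / (N + 1)) < t then Θ k (t - k * (T / (N + 1))) x else 0)) *
        (FunctionSpaces.Torus.timeDeriv ψ t x + ⟪u t x, FunctionSpaces.Torus.gradient (ψ t) x⟫_ℝ +
          κ * FunctionSpaces.Torus.laplacian (ψ t) x)) =
      -∑ k ∈ Finset.range (N + 1), T / (N + 1) * ∫ x, h x * ψ (k * (T / (N + 1))) x := by
  set δ : ℝ := T / (N + 1) with hδ
  have hδ0 : 0 < δ := by positivity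
  set μ : Measure (ℝ × UnitAddTorus d) :=
    ((volume : Measure ℝ).restrict (Ioo 0 T)).prod (volume : Measure (UnitAddTorus d)) with hμ
  set G : ℝ → UnitAddTorus d → ℝ := fun t x =>
    FunctionSpaces.Torus.timeDeriv ψ t x + ⟪u t x, FunctionSpaces.Torus.gradient (ψ t) x⟫_ℝ +
      κ * FunctionSpaces.Torus.laplacian (ψ t) x with hG
  obtain ⟨M, hGm, hGbd, -⟩ := exists_bound_weakIntegrand (κ := κ) hu hψ
  -- the releases `Λ_k` are integrable on `(0,T) × T^d`
  set Λ : ℕ → ℝ → UnitAddTorus d → ℝ := fun k t x => if (k : ℝ) * δ < t then Θ k (t - k * δ) x else 0 with hΛ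
  have hΛi : ∀ k, Integrable (uncurry (Λ k)) μ := by
    intro k
    have hk0 : 0 ≤ (k : ℝ) * δ := by positivity
    obtain ⟨B, hB⟩ := (hΘ k).exists_eLpNorm_le
    refine integrable_uncurry_of_ae_eLpNorm_le (B := B) ENNReal.coe_ne_top
      (aestronglyMeasurable_uncurry_release hk0 (hΘ k).aestronglyMeasurable_uncurry) ?_
    refine ae_release_slice (T := T) (a := k * δ) (Θ := Θ k) (R := fun _ φ => eLpNorm φ 2 volume ≤ B) ?_ ?_
    · filter_upwards [hB] with τ hτ
      exact hτ
    · intro t _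
      have e : (fun _ : UnitAddTorus d => (0 : ℝ)) = 0 := rfl
      rw [e, eLpNorm_zero]
      exact zero_le
  have hΛG : ∀ k, Integrable (fun p : ℝ × UnitAddTorus d => Λ k p.1 p.2 * G p.1 p.2) μ := fun k =>
    (hΛi k).mul_bdd hGm hGbd
  -- each release pairs to `-∫ h ψ(kδ)`
  have hpair : ∀ k, (∫ t in Ioo 0 T, ∫ x, Λ k t x * G t x) = -∫ x, h x * ψ (k * δ) x := by
    intro k
    have hk0 : 0 ≤ (k : ℝ) * δ := by positivity
    exact integral_release_mul_weakIntegrand hk0 (hΘ k) hψ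
  -- linearity
  have e1 : ∀ t x, (∑ k ∈ Finset.range (N + 1), δ * Λ k t x) * G t x =
      ∑ k ∈ Finset.range (N + 1), δ * (Λ k t x * G t x) := by
    intro t x
    rw [Finset.sum_mul]
    refine Finset.sum_congr rfl fun k _ => ?_
    ring
  have hSi : Integrable (fun p : ℝ × UnitAddTorus d =>
      ∑ k ∈ Finset.range (N + 1), δ * (Λ k p.1 p.2 * G p.1 p.2)) μ :=
    integrable_finsetSum _ fun k _ => (hΛG k).const_mul δ
  change (∫ t in Ioo 0 T, ∫ x, (∑ k ∈ Finset.range (N + 1), δ * Λ k t x) * G t x) =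
    -∑ k ∈ Finset.range (N + 1), δ * ∫ x, h x * ψ (k * δ) x
  simp_rw [e1]
  have e2 : (∫ t in Ioo 0 T, ∫ x, ∑ k ∈ Finset.range (N + 1), δ * (Λ k t x * G t x)) =
      ∫ p, ∑ k ∈ Finset.range (N + 1), δ * (Λ k p.1 p.2 * G p.1 p.2) ∂μ :=
    (integral_prod _ hSi).symm
  rw [e2, integral_finsetSum _ (fun k _ => (hΛG k).const_mul δ), ← Finset.sum_neg_distrib]
  refine Finset.sum_congr rfl fun k _ => ?_
  rw [integral_const_mul, integral_prod _ (hΛG k), hpair k, mul_neg]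

end Superposition

end LapInventory

end Summit.AnomalousDissipation.AnomalousDissipation.Theorems

end
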